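import Summits.ValiantsHypothesis.ValiantsHypothesis.Theorems.LacunarySymmetroidMatrixDescartesKFourColumnTwoSided

/-!
# `MatrixDescartes` census — Table-S rows from the Lagrange towers (instances of the all-`m` theorems)

HONEST FRAMING.  Object-search cell `pub-symmetroid`, crux `Theses.LacunarySymmetroid.MatrixDescartes`
(stmt-ValiantsHypothesis-18050); seat val-sym-mdr-p1 (g2).  Pure corollary file (no definitions): the census rows of record that are
INSTANCES of the two all-`m` tree theorems `LagrangeTower.not_posRootLawAt_three` (A3: `ζ_sym(m,3) = C(m+2,2) − 1`) and
`LagrangeTower.not_posRootLawAt_four` (P4: `ζ_sym(m,4) ≥ m² + 2m`), stated as `¬ PosRootLawAt m K B` numerals so that the census tables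
can cite kernel declarations: `(8,3) ≥ 44`, `(9,3) ≥ 54`, `(10,3) ≥ 65` (conjb-3 g3 lagtower rows, R1321), `(6,4) ≥ 48`, `(7,4) ≥ 63`,
`(8,4) ≥ 80` (conjb-3 g4 tower4 rows, R1366 two seats), `(9,4) ≥ 99`, `(10,4) ≥ 120` (conjb-3's registered predictions) and the
square-tower datum `(16,4) ≥ 288` (O-PIN-2).  Lower bounds only; finite rows; nothing here bears on the crux `MatrixDescartes`, on the
K = 4 cubic-vs-quadratic fork, on DoorA26/DoorA34, or on `VP ≠ VNP`.
-/

-- `Summit.ValiantsHypothesis.ValiantsHypothesis.…` repeats a component by the D-0017 layout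
-- (single-conjunct summit), which the `dupNamespace` linter flags; the name is mandated.
set_option linter.dupNamespace false

namespace Summit.ValiantsHypothesis.ValiantsHypothesis.Theorems.LacunarySymmetroidMatrixDescartes.Census.LagrangeTower

open Summit.ValiantsHypothesis.ValiantsHypothesis.Theorems.MatrixDescartes.Negative (PosRootLawAt)

/-- `ζ_sym(8,3) ≥ 44` (row of record `(8,3) = 44`). -/
theorem row_8_3 : ¬ PosRootLawAt 8 3 43 := by
  have h := not_posRootLawAt_three 8 (by norm_num)
  have e : Nat.choose (8 + 2) 2 - 2 = 43 := by decide
  rwa [e] at h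

/-- `ζ_sym(9,3) ≥ 54` (row of record `(9,3) = 54`). -/
theorem row_9_3 : ¬ PosRootLawAt 9 3 53 := by
  have h := not_posRootLawAt_three 9 (by norm_num)
  have e : Nat.choose (9 + 2) 2 - 2 = 53 := by decide
  rwa [e] at h

/-- `ζ_sym(10,3) ≥ 65` (row of record `(10,3) = 65`). -/
theorem row_10_3 : ¬ PosRootLawAt 10 3 64 := by
  have h := not_posRootLawAt_three 10 (by norm_num)
  have e : Nat.choose (10 + 2) 2 - 2 = 64 := by decide
  rwa [e] at h

/-- `ζ_sym(6,4) ≥ 48` (row of record, two seats). -/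
theorem row_6_4 : ¬ PosRootLawAt 6 4 47 := by
  have h := not_posRootLawAt_four 6 (by norm_num)
  have e : (6 + 1) ^ 2 - 2 = 47 := by norm_num
  rwa [e] at h

/-- `ζ_sym(7,4) ≥ 63` (row of record, two seats). -/
theorem row_7_4 : ¬ PosRootLawAt 7 4 62 := by
  have h := not_posRootLawAt_four 7 (by norm_num)
  have e : (7 + 1) ^ 2 - 2 = 62 := by norm_num
  rwa [e] at h

/-- `ζ_sym(8,4) ≥ 80` (row of record, two seats). -/
theorem row_8_4 : ¬ PosRootLawAt 8 4 79 := by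
  have h := not_posRootLawAt_four 8 (by norm_num)
  have e : (8 + 1) ^ 2 - 2 = 79 := by norm_num
  rwa [e] at h

/-- `ζ_sym(9,4) ≥ 99` (conjb-3's registered prediction, now a theorem). -/
theorem row_9_4 : ¬ PosRootLawAt 9 4 98 := by
  have h := not_posRootLawAt_four 9 (by norm_num)
  have e : (9 + 1) ^ 2 - 2 = 98 := by norm_num
  rwa [e] at h

/-- `ζ_sym(10,4) ≥ 120` (conjb-3's registered prediction, now a theorem). -/
theorem row_10_4 : ¬ PosRootLawAt 10 4 119 := by
  have h := not_posRootLawAt_four 10 (by norm_num)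
  have e : (10 + 1) ^ 2 - 2 = 119 := by norm_num
  rwa [e] at h

/-- The square-tower datum `ζ_sym(16,4) ≥ 288` (O-PIN-2: natural towers reach `288` of the `968` that
`Census.not_matrixDescartes_of_squareTowerExtremal` would need at `K = 4`). -/
theorem row_16_4 : ¬ PosRootLawAt 16 4 287 := by
  have h := not_posRootLawAt_four 16 (by norm_num)
  have e : (16 + 1) ^ 2 - 2 = 287 := by norm_num
  rwa [e] at h

end Summit.ValiantsHypothesis.ValiantsHypothesis.Theorems.LacunarySymmetroidMatrixDescartes.Census.LagrangeTower
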